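import Mathlib
import HarnessLib
import Summits.HubbardSuperconductivity.HubbardSuperconductivity.Theorems.KLProgrammeKLRegimeEngineIsoTorusDefs
import Summits.HubbardSuperconductivity.HubbardSuperconductivity.Theorems.KLProgrammeKLRegimeEngineScaleZeroAssembly

/-!
# The scale-0 rung of the K3 engine keyed to the named isotropic torus bound `IsoTorusBoundAt` / the constant `klIsoT`

Cell `gate-hubbard-kl`, seat p3 g6 (scale-`0` assembler of record).  `…EngineScaleZeroAssembly` (p495704) proved the five-clause conclusion
of `stub_engine_scale0` from (E4)₀ and a torus bound `hT` stated inline; `…EngineIsoTorusDefs` names that bound `IsoTorusBoundAt T` under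
exactly the stub's binders and fixes the engine constant `klIsoT`.  Here the two are composed:

* `isoTupleL1AtS_zero_of_isoTorusBoundAt` — (E5-S)₀ at scale `0` from `IsoTorusBoundAt T`, `0 ≤ T`, `T ^ 4 ≤ G.CF` (any `G`), stub binders;
* **`engineScaleZero_of_isoTorusBoundAt`** — the literal five-clause conclusion of `stub_engine_scale0` at `(G, klEngQ5 P R)` for any
  well-formed `G` with `T ^ 4 ≤ G.CF`, from `IsoTorusBoundAt T` and (E4)₀ `hE4`;
* **`engineScaleZero_of_isoTorusBoundAt_klIsoT`** — the same keyed to `klIsoT` (`klIsoT ^ 4 ≤ G.CF`; at `klEngGeo4` this is `le_max_right`):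
  after (J3) (`IsoTorusBoundAt T̂`, p4 g7) and (E4)₀ (k3c2-p1 g3), `stub_engine_scale0` at the swapped package is this lemma applied.
-/

namespace Summit.HubbardSuperconductivity.HubbardSuperconductivity.Theorems.EngineV8

noncomputable section

open Real Finset Literature.MathematicalPhysics.QuantumLattice Literature.Probability.LatticeModels
open Summit.HubbardSuperconductivity.HubbardSuperconductivity.Theorems.KLRegimeSplit
open Summit.HubbardSuperconductivity.HubbardSuperconductivity.Theorems.KLProgrammeLegKernels
open scoped ComplexConjugate

/-- **(E5-S)₀ from the named isotropic torus bound**: `IsoTorusBoundAt T`, `0 ≤ T`, `T ^ 4 ≤ G.CF` and the binders of `stub_engine_scale0`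
give `IsoTupleL1AtS L M G P β U μ K 0`. -/
theorem isoTupleL1AtS_zero_of_isoTorusBoundAt {T : ℝ} (hT0 : 0 ≤ T) (hT : IsoTorusBoundAt T) {G : GeoConsts} (P : SplitConsts)
    (R : RenConsts) (c : ℝ) (hP : P.WF) (hR : R.WF2) (hc : 0 < c) (hc₃ : c ≤ klEngC₃3 P R) (μ : ℝ) (hμ : μ ∈ klWindowC) (U : ℝ)
    (hU : 0 < U) (hU₀ : U ≤ klEngU₀3 P R c) (β : ℝ) (hβ : klBetaMin ≤ β) (hβc : β ≤ Real.exp (c / U ^ 2)) (K : TrigPolyC4v)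
    (hK : FrameOK R U (nScales β) μ K) (L M : ℕ) [NeZero L] [NeZero M] (hL : klEngL₃ β U ≤ L) (hM : klEngM₃ β U L ≤ M)
    (hCF : T ^ 4 ≤ G.CF) : IsoTupleL1AtS L M G P β U μ K 0 :=
  isoTupleL1AtS_zero_of_klEngU₀3 hR.wf hU hU₀ hβ hK hL hM hT0
    (hT P R c hP hR hc hc₃ μ hμ U hU hU₀ β hβ hβc K hK L M hL hM) hCF

/-- **The scale-0 rung from the named isotropic torus bound and (E4)₀**, at `(G, klEngQ5 P R)` for any well-formed `G` with `T ^ 4 ≤ G.CF`: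
the literal five-clause conclusion of `stub_engine_scale0` (with `G` for `klEngGeo3`). -/
theorem engineScaleZero_of_isoTorusBoundAt {T : ℝ} (hT0 : 0 ≤ T) (hT : IsoTorusBoundAt T) (G : GeoConsts) (hG : G.WF)
    (hCF : T ^ 4 ≤ G.CF) (P : SplitConsts) (R : RenConsts) (c : ℝ) (hP : P.WF) (hR : R.WF2) (hc : 0 < c) (hc₃ : c ≤ klEngC₃3 P R)
    (μ : ℝ) (hμ : μ ∈ klWindowC) (U : ℝ) (hU : 0 < U) (hU₀ : U ≤ klEngU₀3 P R c) (β : ℝ) (hβ : klBetaMin ≤ β)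
    (hβc : β ≤ Real.exp (c / U ^ 2)) (K : TrigPolyC4v) (hK : FrameOK R U (nScales β) μ K) (L M : ℕ) [NeZero L] [NeZero M]
    (hL : klEngL₃ β U ≤ L) (hM : klEngM₃ β U L ≤ M) (hE4 : EngineFirstMoments L M G P (klEngQ5 P R) β U μ K 0) :
    KernelNormsV4 L M P (klEngQ5 P R) β U μ K 0 ∧ PairLadderStepAtV9 L M G P (klEngQ5 P R) β U μ K 0 ∧
      QuarticValueUVAtS2 L M G P (klEngQ5 P R) β U μ K 0 ∧ EngineFirstMoments L M G P (klEngQ5 P R) β U μ K 0 ∧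
        IsoTupleL1AtS L M G P β U μ K 0 :=
  engineScaleZero_klEngQ5_of G hG P R c hP hR hc hc₃ μ hμ U hU hU₀ β hβ hβc K hK L M hL hM hE4 hT0
    (hT P R c hP hR hc hc₃ μ hμ U hU hU₀ β hβ hβc K hK L M hL hM) hCF

/-- **The scale-0 rung keyed to the engine constant `klIsoT`**: any witness `IsoTorusBoundAt T` (`0 ≤ T`), any well-formed `G` with
`klIsoT ^ 4 ≤ G.CF`, the stub binders and (E4)₀ give the five-clause conclusion of `stub_engine_scale0` at `(G, klEngQ5 P R)`. -/
theorem engineScaleZero_of_isoTorusBoundAt_klIsoT {T : ℝ} (hT0 : 0 ≤ T) (hT : IsoTorusBoundAt T) (G : GeoConsts) (hG : G.WF)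
    (hCF : klIsoT ^ 4 ≤ G.CF) (P : SplitConsts) (R : RenConsts) (c : ℝ) (hP : P.WF) (hR : R.WF2) (hc : 0 < c)
    (hc₃ : c ≤ klEngC₃3 P R) (μ : ℝ) (hμ : μ ∈ klWindowC) (U : ℝ) (hU : 0 < U) (hU₀ : U ≤ klEngU₀3 P R c) (β : ℝ)
    (hβ : klBetaMin ≤ β) (hβc : β ≤ Real.exp (c / U ^ 2)) (K : TrigPolyC4v) (hK : FrameOK R U (nScales β) μ K) (L M : ℕ)
    [NeZero L] [NeZero M] (hL : klEngL₃ β U ≤ L) (hM : klEngM₃ β U L ≤ M)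
    (hE4 : EngineFirstMoments L M G P (klEngQ5 P R) β U μ K 0) :
    KernelNormsV4 L M P (klEngQ5 P R) β U μ K 0 ∧ PairLadderStepAtV9 L M G P (klEngQ5 P R) β U μ K 0 ∧
      QuarticValueUVAtS2 L M G P (klEngQ5 P R) β U μ K 0 ∧ EngineFirstMoments L M G P (klEngQ5 P R) β U μ K 0 ∧
        IsoTupleL1AtS L M G P β U μ K 0 :=
  engineScaleZero_of_isoTorusBoundAt klIsoT_nonneg (isoTorusBoundAt_klIsoT hT0 hT) G hG hCF P R c hP hR hc hc₃ μ hμ U hU hU₀ β hβ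
    hβc K hK L M hL hM hE4

end

end Summit.HubbardSuperconductivity.HubbardSuperconductivity.Theorems.EngineV8
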